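import Summits.Schanuel.Schanuel.Theorems.DiophantineDichotomyKhovanskiiApproxTypeEvDefs
import Summits.Schanuel.Schanuel.Theorems.DiophantineDichotomyKhovanskiiApproxTypeEvLWMeasure
import Summits.Schanuel.Schanuel.Theorems.DiophantineDichotomyKhovanskiiApproxTypeEvRareFieldThreeLayers
import Summits.Schanuel.Schanuel.Theorems.DiophantineDichotomyKhovanskiiApproxTypeEvPairSumMeasureRank
import Summits.Schanuel.Schanuel.Theorems.DiophantineDichotomyKhovanskiiApproxTypeEvMinimalClause
import Summits.Schanuel.Schanuel.Theorems.DiophantineDichotomyKhovanskiiApproxTypeEvExpAlgClauseMeasure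
import Summits.Schanuel.Schanuel.Theorems.DiophantineDichotomyKhovanskiiApproxTypeEvPairSumCoordMeasure
import Summits.Schanuel.Schanuel.Theorems.DiophantineDichotomyKhovanskiiApproxTypeEvLWGameValue
import Summits.Schanuel.Schanuel.Theorems.DiophantineDichotomyKhovanskiiApproxTypeEvSumCompositionClause
import Summits.Schanuel.Schanuel.Theorems.DiophantineDichotomyKhovanskiiApproxTypeEvOrderDefectPrint
import Summits.Schanuel.Schanuel.Theorems.DiophantineDichotomyKhovanskiiApproxTypeEvLinearFormCertificate
-- Side results of the line (landed, NOT needed by the composition below, hence not imported here so that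
-- this skeleton elaborates independently of the hub's build backlog):
--   …Theorems.DiophantineDichotomyKhovanskiiApproxTypeEvAnchoredBasis     (p97925)
--   …Theorems.DiophantineDichotomyKhovanskiiApproxTypeEvAnchoredReduction (p105406)
--   …Theorems.DiophantineDichotomyKhovanskiiApproxTypeEvUnanchoring       (p107263)
--   …Theorems.DiophantineDichotomyKhovanskiiApproxTypeEvRaceAnchored      (p111284)
--   …Theorems.DiophantineDichotomyKhovanskiiApproxTypeEvFlagship          (p112678, p113183)
--   …Theorems.DiophantineDichotomyKhovanskiiApproxTypeEvLWTwo            (p111331; imported via …EvLWMeasure)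
--   …Theorems.DiophantineDichotomyKhovanskiiApproxTypeEvIffStubs / …CruxBarriers (p125111 / p125943; via …ThreeLayers)

/-!
# Line `anchored-reduction` (`Sketch`) — crux `DiophantineDichotomy.KhovanskiiApproxTypeEv` (stmt-Schanuel-14972)
# Skeleton v16 (lead `prover-line-stmt-Schanuel-14972-c14-0`, 2026-08-17; v14/v15 same lead; v12/v13 by c13; v10/v11 by c12; v8/v9 by c11; v7 by c10; v1–v6 by leads 0,
# c1–c4, re-registered c6–c9; idea card `Cruxes/KhovanskiiApproxTypeEv/Ideas/anchored-reduction.md`; `PICKED.md`)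

**v16 = v15 + sub-goal J₀ `stub_anchoredSyncCore` (the engine of J/K registered separately so that the two files stay ≤ 400 lines; its
synchronised slots are indexed by VALUES, so `(1, e)` — where `e` is both `s₂` and `e^{s₁}` — also gets the floor `1/2`).**

**v15 = v14 + sub-goals J `stub_anchoredSyncFloor` / K `stub_flagshipFloorHalf` (the anchored floor: one wild coordinate with algebraic
exponential; flagship `(1, iπ)` floor `1/2`, `EPiSimultaneousTypeEv` window `[1/2, 1)` unconditional); H LANDED (p172470, worker, wave 1).**

**v14 = v13 + two registered sub-goals H `stub_syncDiazSlot` / I `stub_lwSynchronisedFloor`: the Dirichlet floor `a ≥ 1/n` of leaf B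
at EVERY Lindemann–Weierstrass point of every rank, from Diaz (PROVED) + the linear-in-degree clause measure of `e^β` (sub-goal B, PROVED) —
the synchronisation that `Disproof.lean` §(c)/§(e) declared unavailable; sorries = the three leaves + H + I; `KhovanskiiApproxTypeEv_of` unchanged.**

**v12 = v11 + sub-goal F's import ENABLED (`…EvOrderDefectPrint`, p150635, olean now built) with the side-by-side composition
`leafB_window_rank_three` turned on, + ONE new registered sub-goal G `stub_linearFormCertificate` (the crux-strategist's "first
lemma, provable now" of the leaf-B idea `order-defect-certificates`: `OrderDefectMeasure n κ → LinearFormCertificate n κ`,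
`Cruxes/KhovanskiiApproxTypeEv/SketchIdea.lean`, unfolded) and its unconditional instance `linearFormCertificate_print` (`κ = n`,
G ∘ F).  v13: G LANDED (p154225, worker, wave 1) and imported — sorries = the three leaves only.  `KhovanskiiApproxTypeEv_of` unchanged.**

**v11 = v10 with ALL SIX sub-goals LANDED and imported (sorries = the three leaves only).**  v10 (= v9 + the
rank-`n` leaf-B certificate p146445 imported) registered six sub-goals for the PROVED / PRINT side of leaf B,
unconditional, all ACCEPTED `--supports stmt-Schanuel-14972` this seat:
A `stub_minimalClause` (…EvMinimalClause, p148924) · B `stub_expAlgIrredClauseMeasure` (…EvExpAlgClauseMeasure,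
p148854: Mahler 1932 / Ably 1994 at `m = 1` in clause currency, LINEAR in the degree, via `evLWDh` at rank 1) ·
C `stub_pairSumCoordMeasure` (…EvPairSumCoordMeasure, p149809: `|x + y − e^β| ≥ exp(−C k³ log H)`, print `κ = 3` —
the conclusions of p146020 / p146445 HOLD with `κ = 3`: `pairSum_measure_print`, `alternatingSum_measure_print`,
`pairSum_measure_print_rank` below) · D `stub_evLWGameValue` (…EvLWGameValue, p150093: **the naive LW layer HOLDS
with the certificate-game value `a = (n+1)/(2n)` at every rank** — rank 3 `a = 2/3` against leaf B's demand `a < 1/2`,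
rank 2 `a = 3/4`; single-slot certificate A+B versus full-tuple certificate `evLWDh` p137028; method-optimal by
`certificate_value` p136514) · E `stub_sumCompositionClause` (…EvSumCompositionClause, p149856) ·
F `stub_orderDefectMeasurePrint` (…EvOrderDefectPrint, p150635: the print baseline `κ = n` of the strategist's typed
missing input M2 = `OrderDefectMeasure n n` unfolded, Ably 1994 at `m = n` on `P ∘ (x₁ + ⋯ + xₙ)`).
So leaf B's located open problem is pinned in the kernel on BOTH sides: proved `a = (n+1)/(2n)` / `κ = 3` / `κ_M2 = n`
versus demanded `a < 1/(n−1)` (leaf B) ⟹ `κ < 5/2` at rank 3, `κ < (2n−1)/(n−1)` at rank `n` (p146020 / p146445).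


Crux (route `DiophantineDichotomy`, FIXED): for `n ≥ 2` and every free Khovanskii point
`θ = (s, e^s) ∈ ℂ²ⁿ` with `ℚ`-linearly independent `s`, `∃ a < 1/(n−1), b, C > 0` such that for every
degree budget `d` there is `H₀(d)` with `‖γ − θ‖ ≥ exp(−C(dᵃ log H + dᵇ))` for all `H ≥ H₀(d)` and all
algebraic challengers `γ` of level `(d, H)`.

**v7 = v6 RESHAPED along the crux-strategist's typed three-leaf split** (`Cruxes/KhovanskiiApproxTypeEv/
STRATEGY-CENSUS.md` §5, `Split.lean`): the registered stub `stub_evRankThreeUp : EvRankThreeUp` of v6 is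
replaced by its two layers (`evRankThreeUp_iff_layers'`, p136816), so the skeleton's sorries are now exactly the
three leaves of the split, by NATURE:
* `stub_evNonLW_two : EvNonLWTwo` (= leaf `NonLWLayerRankTwo`, `Iff.rfl`) — CONJECTURE-GRADE: in the tree it
  implies `Literature.NumberTheory.Transcendental.ExpOnePiAlgebraicIndependent` (e ⊥ π, p124086), `πi ⊥ log 2`,
  `log 2 ⊥ log 3` (p124970), `e ⊥ e^e` (p139808), a log-H-linear simultaneous measure at (π, e^π) (p139955);
* `stub_evLW_rankThreeUp : ∀ n, 3 ≤ n → EvLW n` (= leaf `LWLayerRankThreeUp`) — the NAIVE-currency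
  Lindemann–Weierstrass layer at rank ≥ 3: transcendence degree KNOWN at every point it speaks about, no
  catalogued transcendence barrier; open for a CERTIFICATIONAL reason (every (degree, absolute-height)-priced
  certificate equalises at `(n+1)/(2n) ≥ 1/(n−1)`, `…RareFieldCertificateGame.lean` p136514; missing inputs
  M1/M2 of STRATEGY-CENSUS §7, unprinted); its `(d,h)`-currency form `EvLWDh` is a THEOREM at every rank
  (`evLWDh`, p137028) and rank 2 is a theorem in naive currency (`stub_evLW_two`, `a = 3/4`, p123471, imported);
* `stub_evNonLW_rankThreeUp : EvNonLWRankThreeUp` (= leaf `NonLWLayerRankThreeUp`, `Iff.rfl`) —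
  CONJECTURE-GRADE: implies two algebraically independent logarithms of algebraic numbers among
  `log 2, log 3, 2πi` (p124970; barrier `AlgebraicIndependenceOfLogarithms`) and `2 ≤ trdeg` at every rank-≥3
  free point (p124730).
The three stubs are JOINTLY EQUIVALENT to the crux (`khovanskiiApproxTypeEv_iff_threeLayers`, p136816 — the
composition below is its easy direction), hence the crux as filed implies `ExpOnePiAlgebraicIndependent`
unconditionally (`barriers_of_khovanskiiApproxTypeEv`, p125943): the item is parked on that conjecture.

Everything provable in the line has LANDED (all `--supports stmt-Schanuel-14972`, sorry-free, axioms standard):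
`stub_anchoredBasis` (p97925), `stub_anchoredReduction` (p105406), `stub_unanchoring` (p107263),
`stub_raceAnchored` (p111284), `stub_evLW_two_of_ably` (p111331), `stub_evLW_two : EvLWTwo` (p123471, after
Ably 1994 was discharged in Literature, p121092), flagship glue (p112678/p113183), hardness certificates
(p124086 p124730 p124970 p125111 p125943 p126140 p126206 p139808 p139955), three-layer refinement (p136816).

Disproof used (`Cruxes/KhovanskiiApproxTypeEv/Disproof.lean`, cdisprove cycle 1 v3, unchanged since
2026-08-16T12:08Z, re-read by c10): NO KILL; load-bearing hypotheses honoured by every layer; floor `a ≥ 1/2`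
at `n = 2` on both layers (p100002 / p100647) consistent with `EvLWTwo` (`a = 3/4`) and `EvNonLWTwo` (`a < 1`);
near-misses `_false_without_khovanskii`, `floor_third_at_lw_three` (window `[1/3, 1/2)` for
`stub_evLW_rankThreeUp` at `n = 3`) do not touch the stubs; joint sufficiency honest.
-/

noncomputable section

set_option linter.dupNamespace false

open scoped BigOperators

namespace Summit.Schanuel.Schanuel.Cruxes.KhovanskiiApproxTypeEv.AnchoredReduction

open Summit.Schanuel.Schanuel.Theses.DiophantineDichotomy
  (KhovanskiiApproxTypeEv ApproximationProperty EPiSimultaneousTypeEv)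
open Summit.Schanuel.Schanuel.Cruxes.KhovanskiiApproxType.LwSmallHeight (IsFreeKhovanskii)
open Summit.Schanuel.Schanuel.Cruxes.KhovanskiiApproxTypeEv.RareFieldSpecies
  (EvLW EvNonLWRankThreeUp khovanskiiApproxTypeEv_iff_threeLayers evRankThreeUp_of_layers)
open Complex

/-! Vocabulary: `Theorems/DiophantineDichotomyKhovanskiiApproxTypeEvDefs.lean` (p97082):
`ApproxTypeEvAt`, `khovanskiiApproxTypeEv_iff`, `EvLWTwo`, `EvNonLWTwo`, `EvRankThreeUp`, …;
`Theorems/DiophantineDichotomyKhovanskiiApproxTypeEvRareFieldDefs.lean` (p136201): `EvLW`, `EvNonLWRankThreeUp`. -/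

/-! ## Registered stubs (v7–v10): the three leaves -/

/-- STUB A = leaf `NonLWLayerRankTwo` (CONJECTURE-GRADE, Schanuel-rank-2 strength pointwise: in the tree it
implies `AlgebraicIndependent ℚ ![Real.exp 1, Real.pi]` unconditionally; the route needs it only at `(1, iπ)`,
where it is the route item `EPiSimultaneousTypeEv`, stmt-Schanuel-14975). -/
theorem stub_evNonLW_two : EvNonLWTwo := by
  sorry

/-- STUB B = leaf `LWLayerRankThreeUp` (the naive-currency Lindemann–Weierstrass layer at every rank `n ≥ 3`;
trdeg known, no transcendence barrier; open for a certificational reason — cap `(n+1)/(2n)`, p136514). -/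
theorem stub_evLW_rankThreeUp : ∀ n : ℕ, 3 ≤ n → EvLW n := by
  sorry

/-- STUB C = leaf `NonLWLayerRankThreeUp` (CONJECTURE-GRADE: ⊇ two algebraically independent logarithms of
algebraic numbers, barrier `AlgebraicIndependenceOfLogarithms`, p124970). -/
theorem stub_evNonLW_rankThreeUp : EvNonLWRankThreeUp := by
  sorry

/-! ## Registered sub-goals of v8 (lead c11): the KERNEL HARDNESS CERTIFICATE for stub B — ALL LANDED

Stub B was the only leaf without a kernel certificate (A: p124086/p139808/p139955; C: p124970).  The `S_k`-sum
species of STRATEGY-CENSUS §7.1 run BACKWARDS gives one: from `EvLW 3`, at every LW triple `s`, three INDEPENDENT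
algebraic numbers `α₀, α₁, α₂` of degree `≤ k` and naive height `≤ h` cannot have all three pair sums
`α_j + α_{j+1}` within `exp(−C k^κ log h)` of `e^{s_j}`, for some `κ < 5/2` and all `h ≥ h₀(k)` — the challenger
`(s, α₀+α₁, α₁+α₂, α₂+α₀)` has level `(N_s k³, 4^{k²}((k+1)h)^{2k})`, so `dᵃ log H ≍ k^{3a+1} log h`, `3a + 1 < 5/2`;
equivalently (`alternatingSum_measure_of_evLW_three`) the three alternating half-sums
`(e^{s_j} − e^{s_{j+1}} + e^{s_{j+2}})/2` are not simultaneously approximable by independent degree-`k` numbers to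
that order.  In print the exponent is `κ = 3` (Ably 1994 at `m = 3` / `m = 1`); the heuristic truth is `κ = 1`.
All six registered sub-goals LANDED this seat (imported above via `…EvPairSumMeasure`):
`stub_pairSumResultant` (p143374, `Res_Y(P(Y), Q(X−Y))` maps to `lc(P)^{deg Q} ∏ Q(X − aᵢ)`), `stub_pairSumBasic`
(p143503), `stub_pairSumCoeffBound` (p143542, Mahler measure: `|coeff| ≤ 4^{pq}((q+1)B)^p((p+1)A)^q`),
`stub_finrankAdjoinRangeLe` (p143271), `stub_clauseAdd` (p144679), `stub_pairSumMeasure` +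
`alternatingSum_measure_of_evLW_three` + `pairSum_measure_of_khovanskiiApproxTypeEv` (…EvPairSumMeasure, p146020), and the
rank-`n` form `pairSum_measure_of_evLW` (registered sub-goal; `κ < (2n−1)/(n−1) ↘ 2`, print `3` at every rank;
…EvPairSumMeasureRank, p146445). -/

/-- The certificate APPLIED TO STUB B (sorry-free composition): any proof of `stub_evLW_rankThreeUp` proves the
pair-sum measure with `κ < 5/2` at every Lindemann–Weierstrass triple (print: `κ = 3`). -/
theorem pairSum_measure_of_stubB (s : Fin 3 → ℂ)
    (halg : ∀ i, IsAlgebraic ℚ (s i)) (hli : LinearIndependent ℚ s) :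
    ∃ κ C : ℝ, κ < 5 / 2 ∧ 0 < C ∧ ∀ k : ℕ, ∃ h₀ : ℕ, ∀ (H : ℕ) (α : Fin 3 → ℂ), h₀ ≤ H →
      (∀ j, ∃ P : Polynomial ℤ, P ≠ 0 ∧ P.natDegree ≤ k ∧ (∀ l, |P.coeff l| ≤ (H : ℤ)) ∧
        Polynomial.aeval (α j) P = 0) →
      Real.exp (-(C * (k : ℝ) ^ κ * Real.log H)) ≤
        ‖fun j : Fin 3 => α j + α (j + 1) - Complex.exp (s j)‖ :=
  stub_pairSumMeasure (stub_evLW_rankThreeUp 3 le_rfl) s halg hli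

/-- The same in single-number form: any proof of stub B proves that the alternating half-sums
`(e^{s_j} − e^{s_{j+1}} + e^{s_{j+2}})/2` of every LW triple resist simultaneous independent degree-`k`
approximation at order `k^κ log h`, `κ < 5/2` — an `OrderDefectMeasure`-type statement (STRATEGY-CENSUS §7 M2)
whose printed exponent is `3`. -/
theorem alternatingSum_measure_of_stubB (s : Fin 3 → ℂ)
    (halg : ∀ i, IsAlgebraic ℚ (s i)) (hli : LinearIndependent ℚ s) :
    ∃ κ C : ℝ, κ < 5 / 2 ∧ 0 < C ∧ ∀ k : ℕ, ∃ h₀ : ℕ, ∀ (H : ℕ) (α : Fin 3 → ℂ), h₀ ≤ H →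
      (∀ j, ∃ P : Polynomial ℤ, P ≠ 0 ∧ P.natDegree ≤ k ∧ (∀ l, |P.coeff l| ≤ (H : ℤ)) ∧
        Polynomial.aeval (α j) P = 0) →
      Real.exp (-(C * (k : ℝ) ^ κ * Real.log H)) ≤
        ‖fun j : Fin 3 => α j -
          (Complex.exp (s j) - Complex.exp (s (j + 1)) + Complex.exp (s (j + 2))) / 2‖ :=
  alternatingSum_measure_of_evLW_three (stub_evLW_rankThreeUp 3 le_rfl) s halg hli

/-- The rank-`n` certificate APPLIED TO STUB B (sorry-free composition; `pairSum_measure_of_evLW_rankThreeUp`,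
p146445): any proof of `stub_evLW_rankThreeUp` proves, at every rank `n ≥ 3` and every LW `n`-tuple, the cyclic
pair-sum measure with `κ < (2n−1)/(n−1)` (print: `κ = 3`, `pairSum_measure_print_rank` below). -/
theorem pairSum_measure_rank_of_stubB {n : ℕ} (hn : 3 ≤ n) (s : Fin n → ℂ)
    (halg : ∀ i, IsAlgebraic ℚ (s i)) (hli : LinearIndependent ℚ s) :
    ∃ κ C : ℝ, κ < (2 * n - 1) / ((n : ℝ) - 1) ∧ 0 < C ∧ ∀ k : ℕ, ∃ h₀ : ℕ, ∀ (H : ℕ) (α : Fin n → ℂ),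
      h₀ ≤ H →
      (∀ j, ∃ P : Polynomial ℤ, P ≠ 0 ∧ P.natDegree ≤ k ∧ (∀ l, |P.coeff l| ≤ (H : ℤ)) ∧
        Polynomial.aeval (α j) P = 0) →
      Real.exp (-(C * (k : ℝ) ^ κ * Real.log H)) ≤
        ‖fun j : Fin n => α j + α (finRotate n j) - Complex.exp (s j)‖ :=
  pairSum_measure_of_evLW_rankThreeUp stub_evLW_rankThreeUp hn s halg hli

/-! ## Sub-goals of v10 (lead c12) — ALL LANDED: the PROVED / PRINT side of leaf B — unconditional

Leaf B's certificate (p146020 / p146445) says: any proof of stub B yields the pair-sum measure with an exponent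
`κ < 5/2` (rank 3), `κ < (2n−1)/(n−1)` (rank `n`).  Its docstrings record "print gives `κ = 3`" — Mahler 1932 /
Ably 1994 at `m = 1` applied to ONE pair sum `x + y` (degree `≤ k²`, naive height `≤ 4^{k²}((k+1)H)^{2k} ≤ H^{5k}`):
`|x + y − e^β| ≥ exp(−c · k² · 5k log H)`.  The three sub-goals below make that a KERNEL theorem from tree material
only: the landed `(d,h)`-currency LW layer `evLWDh` (p137028) at rank 1 is degree-LINEAR on irreducible clauses
(`d := N_β · deg z`, `d²/deg z = N_β² deg z`), an arbitrary clause is replaced by an irreducible one at height cost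
`2^D (D+1)` (UFD factorisation of `ℤ[X]` + Mahler measure, as in `exists_irreducible_factor_of_aeval_eq_zero`,
…LambertExpOneDegreeMeasure), and the pair sum of two level-`(k, H)` clause-numbers is a level-`(k², H^{5k})`
clause-number (`stub_clauseAdd` p144679, `levelHeight_le_pow`). -/

-- `stub_minimalClause`: LANDED (imported above); statement and docstring in its Theorems file.

-- `stub_expAlgIrredClauseMeasure`: LANDED (imported above); statement and docstring in its Theorems file.

-- `stub_pairSumCoordMeasure`: LANDED (imported above); statement and docstring in its Theorems file.

-- `stub_evLWGameValue`: LANDED (imported above); statement and docstring in its Theorems file.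

/-- **STATE OF THE ART OF LEAF B AT RANK 3, in the crux's own vocabulary** (sorry-free composition of sub-goal D):
every Lindemann–Weierstrass triple has eventual approximation type `a = 2/3` (with `b = 2`), unconditionally; stub B
(`EvLW 3`) asks for some `a < 1/2`. [folklore] -/
theorem evLW_three_twoThirds (s : Fin 3 → ℂ) (halg : ∀ i, IsAlgebraic ℚ (s i))
    (hli : LinearIndependent ℚ s) : ∃ C : ℝ, ApproxTypeEvAt 3 s (2 / 3) 2 C := by
  obtain ⟨C, hC⟩ := stub_evLWGameValue 3 s (by norm_num) halg hli
  refine ⟨C, ?_⟩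
  have h : (((3 : ℕ) : ℝ) + 1) / (2 * ((3 : ℕ) : ℝ)) = 2 / 3 := by norm_num
  rw [h] at hC
  exact hC

/-- The same at every rank `n ≥ 3`, next to leaf B's demand: proved exponent `(n+1)/(2n)`, demanded `< 1/(n−1)`,
and `1/(n−1) < (n+1)/(2n)` exactly when `n ≥ 3` (`threshold_lt_cap`, p136514) — the gap is leaf B. [folklore] -/
theorem evLW_gameValue_vs_demand {n : ℕ} (hn : 3 ≤ n) (s : Fin n → ℂ) (halg : ∀ i, IsAlgebraic ℚ (s i))
    (hli : LinearIndependent ℚ s) :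
    (∃ C : ℝ, ApproxTypeEvAt n s (((n : ℝ) + 1) / (2 * n)) 2 C) ∧
      1 / ((n : ℝ) - 1) < ((n : ℝ) + 1) / (2 * n) := by
  refine ⟨stub_evLWGameValue n s (by omega) halg hli, ?_⟩
  have hn' : (3 : ℝ) ≤ n := by exact_mod_cast hn
  rw [div_lt_div_iff₀ (by linarith) (by positivity)]
  nlinarith

/-! ### Sub-goals E–F (v10, wave 2): the print baseline `κ = n` of the order-defect measure M2

STRATEGY-CENSUS §7 types the missing input of leaf B as `OrderDefectMeasure n κ` (`Cruxes/…/SketchIdea.lean`):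
`|P(Σ_j e^{β_j})| ≥ exp(−C D^κ log H)` eventually in `H`, needed with `κ < n − 1/2`, "KNOWN with `κ = n`".  Sub-goal F
makes the known end a kernel theorem (Ably 1994, PROVED p121092, at `m = n` on `P ∘ (x₁ + ⋯ + xₙ)`), through the
bookkeeping sub-goal E (the composed polynomial: non-zero, total degree `≤ D`, height `≤ n^D (D+1) H`). -/

-- `stub_sumCompositionClause`: LANDED (imported above); statement and docstring in its Theorems file.

-- `stub_orderDefectMeasurePrint`: LANDED (imported above); statement and docstring in its Theorems file.

/-- The two ends of leaf B's located problem at rank 3, side by side (sorry-free composition): M2 holds with `κ = 3`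
for every LW triple (sub-goal F, p150635), while stub B forces the alternating-half-sum measure with some `κ < 5/2`
(`alternatingSum_measure_of_stubB`, certificate p146020). [folklore] -/
theorem leafB_window_rank_three (s : Fin 3 → ℂ) (halg : ∀ i, IsAlgebraic ℚ (s i))
    (hli : LinearIndependent ℚ s) :
    (∃ C : ℝ, 0 < C ∧ ∀ D : ℕ, ∃ H₀ : ℕ, ∀ (H : ℕ) (P : Polynomial ℤ), H₀ ≤ H → P ≠ 0 →
      P.natDegree ≤ D → (∀ k, |P.coeff k| ≤ (H : ℤ)) →
        Real.exp (-(C * (D : ℝ) ^ ((3 : ℕ) : ℝ) * Real.log H)) ≤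
          ‖Polynomial.aeval (∑ j, Complex.exp (s j)) P‖) ∧
    (∃ κ C : ℝ, κ < 5 / 2 ∧ 0 < C ∧ ∀ k : ℕ, ∃ h₀ : ℕ, ∀ (H : ℕ) (α : Fin 3 → ℂ), h₀ ≤ H →
      (∀ j, ∃ P : Polynomial ℤ, P ≠ 0 ∧ P.natDegree ≤ k ∧ (∀ l, |P.coeff l| ≤ (H : ℤ)) ∧
        Polynomial.aeval (α j) P = 0) →
      Real.exp (-(C * (k : ℝ) ^ κ * Real.log H)) ≤
        ‖fun j : Fin 3 => α j -
          (Complex.exp (s j) - Complex.exp (s (j + 1)) + Complex.exp (s (j + 2))) / 2‖) :=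
  ⟨stub_orderDefectMeasurePrint 3 (by norm_num) s halg hli, alternatingSum_measure_of_stubB s halg hli⟩

/-- **PRINT SIDE OF LEAF B'S CERTIFICATE, rank 3** (sorry-free composition of sub-goal C at the coordinate `j = 0`):
at every LW triple the conclusion of `stub_pairSumMeasure` (p146020) HOLDS with `κ = 3`, unconditionally — so stub B's
certified demand `κ < 5/2` is exactly an exponent improvement of this theorem (the located order-defect problem,
STRATEGY-CENSUS §7 M2), neither more nor less. [folklore] -/
theorem pairSum_measure_print (s : Fin 3 → ℂ)
    (halg : ∀ i, IsAlgebraic ℚ (s i)) (hli : LinearIndependent ℚ s) :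
    ∃ C : ℝ, 0 < C ∧ ∀ k : ℕ, ∃ h₀ : ℕ, ∀ (H : ℕ) (α : Fin 3 → ℂ), h₀ ≤ H →
      (∀ j, ∃ P : Polynomial ℤ, P ≠ 0 ∧ P.natDegree ≤ k ∧ (∀ l, |P.coeff l| ≤ (H : ℤ)) ∧
        Polynomial.aeval (α j) P = 0) →
      Real.exp (-(C * (k : ℝ) ^ (3 : ℝ) * Real.log H)) ≤
        ‖fun j : Fin 3 => α j + α (j + 1) - Complex.exp (s j)‖ := by
  obtain ⟨C, hC, hall⟩ := stub_pairSumCoordMeasure (s 0) (halg 0) (hli.ne_zero 0)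
  refine ⟨C, hC, fun k => ?_⟩
  obtain ⟨h₀, hh₀⟩ := hall k
  refine ⟨h₀, fun H α hH hcl => ?_⟩
  exact (hh₀ H (α 0) (α (0 + 1)) hH (hcl 0) (hcl (0 + 1))).trans
    (norm_le_pi_norm (fun j : Fin 3 => α j + α (j + 1) - Complex.exp (s j)) 0)

/-- **PRINT SIDE, alternating form, rank 3**: the conclusion of `alternatingSum_measure_of_evLW_three` (p146020) holds
with `κ = 3` unconditionally (`max_j |α_j + α_{j+1} − e^{s_j}| ≤ 2 max_j |α_j − ξ_j|`, `norm_pairSum_sub_le`; the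
factor `2` is absorbed by `C + 1` since `k³ log H ≥ log 2` past `H ≥ 2`, `k ≥ 1`). [folklore] -/
theorem alternatingSum_measure_print (s : Fin 3 → ℂ)
    (halg : ∀ i, IsAlgebraic ℚ (s i)) (hli : LinearIndependent ℚ s) :
    ∃ C : ℝ, 0 < C ∧ ∀ k : ℕ, ∃ h₀ : ℕ, ∀ (H : ℕ) (α : Fin 3 → ℂ), h₀ ≤ H →
      (∀ j, ∃ P : Polynomial ℤ, P ≠ 0 ∧ P.natDegree ≤ k ∧ (∀ l, |P.coeff l| ≤ (H : ℤ)) ∧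
        Polynomial.aeval (α j) P = 0) →
      Real.exp (-(C * (k : ℝ) ^ (3 : ℝ) * Real.log H)) ≤
        ‖fun j : Fin 3 => α j -
          (Complex.exp (s j) - Complex.exp (s (j + 1)) + Complex.exp (s (j + 2))) / 2‖ := by
  obtain ⟨C, hC, hall⟩ := pairSum_measure_print s halg hli
  refine ⟨C + 1, by linarith, fun k => ?_⟩
  obtain ⟨h₀, hh₀⟩ := hall k
  refine ⟨max h₀ 2, fun H α hH hcl => ?_⟩
  have hH0 : h₀ ≤ H := le_trans (le_max_left _ _) hH
  have hH2 : 2 ≤ H := le_trans (le_max_right _ _) hH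
  have hk : 1 ≤ k := one_le_budget_of_clause (hcl 0)
  have key := (hh₀ H α hH0 hcl).trans (norm_pairSum_sub_le (fun j => Complex.exp (s j)) α)
  -- `exp(−(C+1) k³ log H) ≤ exp(−C k³ log H) / 2`
  have hH1r : (1 : ℝ) < H := by exact_mod_cast hH2
  have hlogH : Real.log 2 ≤ Real.log H := Real.log_le_log (by norm_num) (by exact_mod_cast hH2)
  have hk1r : (1 : ℝ) ≤ k := by exact_mod_cast hk
  have hk3 : (1 : ℝ) ≤ (k : ℝ) ^ (3 : ℝ) := Real.one_le_rpow hk1r (by norm_num)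
  have hlog2 : Real.log 2 ≤ (k : ℝ) ^ (3 : ℝ) * Real.log H := by
    calc Real.log 2 ≤ Real.log H := hlogH
      _ = 1 * Real.log H := (one_mul _).symm
      _ ≤ (k : ℝ) ^ (3 : ℝ) * Real.log H :=
          mul_le_mul_of_nonneg_right hk3 (Real.log_nonneg hH1r.le)
  have h2 : Real.exp (-((C + 1) * (k : ℝ) ^ (3 : ℝ) * Real.log H)) ≤
      Real.exp (-(C * (k : ℝ) ^ (3 : ℝ) * Real.log H)) / 2 := by
    rw [le_div_iff₀ (by norm_num : (0 : ℝ) < 2), show (2 : ℝ) = Real.exp (Real.log 2) by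
      rw [Real.exp_log (by norm_num)], ← Real.exp_add, Real.exp_le_exp]
    nlinarith [hlog2]
  have h3 : Real.exp (-(C * (k : ℝ) ^ (3 : ℝ) * Real.log H)) / 2 ≤
      ‖fun j : Fin 3 => α j -
          (Complex.exp (s j) - Complex.exp (s (j + 1)) + Complex.exp (s (j + 2))) / 2‖ := by
    rw [div_le_iff₀ (by norm_num : (0 : ℝ) < 2)]
    linarith [key]
  exact h2.trans h3

/-- **PRINT SIDE OF LEAF B'S CERTIFICATE, every rank `n ≥ 2`** (sorry-free composition of sub-goal C at the
coordinate `j = 0`): the conclusion of `pairSum_measure_of_evLW` (p146445) holds with `κ = 3` at every LW `n`-tuple,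
unconditionally; leaf B demands `κ < (2n−1)/(n−1)`, which is `< 3` for `n ≥ 3` and `↘ 2`. [folklore] -/
theorem pairSum_measure_print_rank {n : ℕ} (hn : 2 ≤ n) (s : Fin n → ℂ)
    (halg : ∀ i, IsAlgebraic ℚ (s i)) (hli : LinearIndependent ℚ s) :
    ∃ C : ℝ, 0 < C ∧ ∀ k : ℕ, ∃ h₀ : ℕ, ∀ (H : ℕ) (α : Fin n → ℂ), h₀ ≤ H →
      (∀ j, ∃ P : Polynomial ℤ, P ≠ 0 ∧ P.natDegree ≤ k ∧ (∀ l, |P.coeff l| ≤ (H : ℤ)) ∧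
        Polynomial.aeval (α j) P = 0) →
      Real.exp (-(C * (k : ℝ) ^ (3 : ℝ) * Real.log H)) ≤
        ‖fun j : Fin n => α j + α (finRotate n j) - Complex.exp (s j)‖ := by
  set i0 : Fin n := ⟨0, by omega⟩ with hi0
  obtain ⟨C, hC, hall⟩ := stub_pairSumCoordMeasure (s i0) (halg i0) (hli.ne_zero i0)
  refine ⟨C, hC, fun k => ?_⟩
  obtain ⟨h₀, hh₀⟩ := hall k
  refine ⟨h₀, fun H α hH hcl => ?_⟩
  exact (hh₀ H (α i0) (α (finRotate n i0)) hH (hcl i0) (hcl (finRotate n i0))).trans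
    (norm_le_pi_norm (fun j : Fin n => α j + α (finRotate n j) - Complex.exp (s j)) i0)

/-! ## Sub-goal G (v12, lead c13): the first lemma of the leaf-B idea `order-defect-certificates`

STRATEGY-CENSUS §7 / `Cruxes/KhovanskiiApproxTypeEv/SketchIdea.lean` type the missing input of leaf B as M2
`OrderDefectMeasure n κ` (print `κ = n` = sub-goal F, p150635; leaf B at rank 3 needs `κ < 5/2`) and name as FIRST LEMMA of the
leaf's future chain the bookkeeping implication `linearFormCertificate_of : OrderDefectMeasure n κ → LinearFormCertificate n κ`:
an order-defect measure for `η = Σ_j e^{s_j}` repels, at the LW point `θ = (s, e^s)`, every challenger whose `y`-coordinates sum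
EXACTLY to a root `ϑ` of a small integer polynomial (`P(η) = P(η) − P(ϑ) = (η − ϑ)·Σ_k a_k Σ_{i<k} ηⁱϑ^{k−1−i}`, `|η − ϑ| ≤ n‖γ − θ‖`;
the factors `n^D`, `D` are absorbed by `C + 1` and a `D`-dependent threshold).  This is the mechanism by which M2 enters the
certificate game against the `S_k`-sum species of §7.1 (`α₁ − α₂ + α₃ = 2θ₁`).  Registered here UNFOLDED (Theorems files cannot
import `Cruxes/…/SketchIdea.lean`; both sides are its `OrderDefectMeasure n κ` / `LinearFormCertificate n κ` bodies verbatim). -/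

-- `stub_linearFormCertificate` (sub-goal G): LANDED p154225 (…EvLinearFormCertificate, imported above); statement and docstring there.

/-- **The linear-form certificate HOLDS with `κ = n`, unconditionally** (sorry-free: composition of sub-goal G, p154225, with the
print baseline F `stub_orderDefectMeasurePrint`, p150635) — `LinearFormCertificate n n` of `SketchIdea.lean`, unfolded: at every LW
point of rank `n ≥ 1`, a challenger whose `y`-coordinates sum exactly to a root of a non-zero `P ∈ ℤ[x]` of degree `≤ D` and height
`≤ H` stays at distance `≥ exp(−C Dⁿ log H)/(n (D+1) H (2 + ‖e^s‖)^D)` past a threshold `H₀(D)`.  Leaf B at rank 3 wants the same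
with an exponent `< 5/2` in place of `3` (STRATEGY-CENSUS §7.1). [folklore] -/
theorem linearFormCertificate_print (n : ℕ) (hn : 1 ≤ n)
    (s : Fin n → ℂ) (halg : ∀ j, IsAlgebraic ℚ (s j)) (hli : LinearIndependent ℚ s) :
    ∃ C : ℝ, 0 < C ∧ ∀ D : ℕ, ∃ H₀ : ℕ, ∀ (H : ℕ) (γ : Fin n ⊕ Fin n → ℂ) (P : Polynomial ℤ),
      H₀ ≤ H → P ≠ 0 → P.natDegree ≤ D → (∀ k, |P.coeff k| ≤ (H : ℤ)) →
      Polynomial.aeval (∑ j, γ (Sum.inr j)) P = 0 → ‖γ - Sum.elim s (Complex.exp ∘ s)‖ ≤ 1 →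
        Real.exp (-(C * (D : ℝ) ^ (n : ℝ) * Real.log H)) /
            (n * (D + 1) * H * (2 + ‖Complex.exp ∘ s‖) ^ D)
          ≤ ‖γ - Sum.elim s (Complex.exp ∘ s)‖ :=
  stub_linearFormCertificate n n (fun β hβ hβli => stub_orderDefectMeasurePrint n hn β hβ hβli) s halg hli

/-! ## Sub-goals H–I (v14, lead c14): the DIRICHLET FLOOR `a ≥ 1/n` of leaf B at EVERY Lindemann–Weierstrass point

`Disproof.lean` §(e) leaves `floor_third_at_lw_three` (the floor `a ≥ 1/3` at an LW 3-point) sorried — "needs AP(3) or synchronised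
Wirsing" — and §(c) records "two independent Diaz approximants in one challenger cannot be height-synchronised … hence no unconditional
floor at `n ≥ 3`".  Both obstructions dissolve with two LANDED tree theorems taken together: Diaz's theorem (`Bugeaud2004_thm_8_11_holds`:
for EVERY scale `M` an `α` with `deg α ≤ m`, `M(α) ≤ M`, `|ξ − α| ≤ exp(−0.006(m log M(α) + deg α · log M))`) and the linear-in-the-degree
clause measure of `e^β` (`stub_expAlgIrredClauseMeasure`, sub-goal B of v10, p148854, from Ably 1994 PROVED): the measure forbids Diaz's
approximant of `ξ = e^β` to have small degree AND small Mahler measure, so at every large scale `M` its degree is `≥ 0.003 m / C_β` and its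
quality is `exp(−q_β m log M)` — uniformly in `M` (sub-goal H).  Running H in each of the `n` slots `e^{s_1}, …, e^{s_n}` of an LW point at
ONE common scale `M` gives challengers `(s, α_1, …, α_n)` of field degree `≤ F_s mⁿ` and quality `exp(−q m log M)`, `q = min_i q_i`, i.e.
exponent `≍ d^{1/n} log H`: no eventual approximation type with `a < 1/n` exists at ANY LW point of ANY rank (sub-goal I).  Consequences
(in the sub-goal I file): leaf B's window at rank `n` is exactly `[1/n, 1/(n−1))` in the kernel (lower end new for `n ≥ 3`; `evLWDh`
p137028 proves `1/n` from ABOVE in `(d,h)` currency, so the naive/`(d,h)` gap of STRATEGY-CENSUS §6 R3 is now two-sidedly pinned), and the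
crux's sharp form `a < 1/n` fails at every rank `n ≥ 2`, not only at `n = 2` (`khovanskiiApproxTypeEv_false_sharp`, p100002). -/

/-- SUB-GOAL H (v14, lead c14; worker): **a SYNCHRONISED Diaz slot** — for algebraic `β ≠ 0` there is `q > 0` such that for every
degree budget `m ≥ 50`, at EVERY sufficiently large scale `M`, some algebraic `α` of degree `≤ m` and Mahler measure `≤ M` satisfies
`|e^β − α| ≤ exp(−q m log M)` (Diaz `Bugeaud2004_thm_8_11_holds` + the clause measure `stub_expAlgIrredClauseMeasure` forcing
`deg α ≥ 0.003 m / C_β`). -/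
theorem stub_syncDiazSlot : ∀ (β : ℂ), IsAlgebraic ℚ β → β ≠ 0 →
    ∃ q : ℝ, 0 < q ∧ ∀ m : ℕ, 50 ≤ m → ∃ M₀ : ℝ, ∀ M : ℝ, M₀ ≤ M →
      ∃ (α : ℂ) (P : Polynomial ℤ), Irreducible P ∧ Polynomial.aeval α P = 0 ∧
        1 ≤ P.natDegree ∧ P.natDegree ≤ m ∧
        (P.map (Int.castRingHom ℂ)).mahlerMeasure ≤ M ∧
        ‖Complex.exp β - α‖ ≤ Real.exp (-(q * m * Real.log M)) := by
  sorry

/-- SUB-GOAL I (v14, lead c14; lead): **the Dirichlet floor `a ≥ 1/n` at EVERY Lindemann–Weierstrass point of every rank `n ≥ 1`**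
— for algebraic non-zero `s_1, …, s_n` no eventual approximation type `(a, b, C)` with `a < 1/n` exists at `θ = (s, e^s)`
(`n` synchronised Diaz slots at a common scale, sub-goal H, in the common field `ℚ(s, α_1, …, α_n)` of degree `≤ F_s mⁿ`). -/
theorem stub_lwSynchronisedFloor : ∀ (n : ℕ) (s : Fin n → ℂ) (a b C : ℝ), 1 ≤ n →
    (∀ i, IsAlgebraic ℚ (s i)) → (∀ i, s i ≠ 0) → a < 1 / (n : ℝ) → ¬ ApproxTypeEvAt n s a b C := by
  sorry

/-! ### Sub-goals J–K (v15, lead c14): the ANCHORED floor — one wild coordinate whose exponential is algebraic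

The same synchronisation with ONE anchor slot handled by plain Diaz at a free scale `M` (self-normalised by its own Mahler measure;
its `deg α · log M` term absorbs every slack, as in `not_approxTypeEvAt_conjPair`) and the sync slots run at the scale
`max(M(α_anchor), T)`: at `θ = (s, e^s)` with `s_{k₀}` arbitrary but `e^{s_{k₀}}` algebraic and every other `s_k` algebraic non-zero,
no eventual type with `a < 1/n` (sub-goal J; engine `anchoredSyncFloor_core` over any finite index type).  Instances (sub-goal K file):
the FLAGSHIP `(1, iπ)` has floor `1/2` unconditionally (leaf A's only route-relevant point; Disproof §(c) had `1/2` only at auxiliary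
conjugate points), the anchored family `(1, iπ, β₃, …)` with algebraic tail has floor `1/(n+2)` against `KhovanskiiApproxTypeEvAnchored`'s
demand `a < 1/(n+1)`, and the route item `EPiSimultaneousTypeEv` (stmt-Schanuel-14975) cannot hold with `a < 1/2` — discharging the
hypothesis `hB` of `Theorems/EPiSimultaneousTypeEv/Negative/CoordinatewiseLinear.lean`. -/

/-- SUB-GOAL J₀ (v16, lead c14): **the anchored synchronised floor, ENGINE** over any finite index type — anchor `i₀` (any complex
number, plain Diaz at a free scale), synchronised indices `Sy` (values `e^{β}`, `β ≠ 0` algebraic; equal values share one approximant),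
all other coordinates algebraic ⇒ no eventual bound `exp(−C(dᵃ log H + dᵇ)) ≤ ‖γ − v‖` with `a < 1/(#v(Sy) + 1)`. -/
theorem stub_anchoredSyncCore : ∀ {ι : Type} [Fintype ι] [DecidableEq ι] (v : ι → ℂ) (i₀ : ι)
    (Sy : Finset ι), i₀ ∉ Sy → (∀ i ∈ Sy, ∃ β : ℂ, IsAlgebraic ℚ β ∧ β ≠ 0 ∧ v i = Complex.exp β) →
    (∀ i, i ∉ Sy → i ≠ i₀ → IsAlgebraic ℚ (v i)) → ∀ (a b C : ℝ), 0 < C →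
    a < 1 / (((Sy.image v).card : ℝ) + 1) →
    (∀ d : ℕ, ∃ H₀ : ℕ, ∀ (H : ℕ) (γ : ι → ℂ), H₀ ≤ H →
      Module.finrank ℚ ↥(IntermediateField.adjoin ℚ (Set.range γ)) ≤ d →
      (∀ i, ∃ P : Polynomial ℤ, P ≠ 0 ∧ P.natDegree ≤ d ∧ (∀ k, |P.coeff k| ≤ (H : ℤ)) ∧
        Polynomial.aeval (γ i) P = 0) →
      Real.exp (-(C * ((d : ℝ) ^ a * Real.log H + (d : ℝ) ^ b))) ≤ ‖γ - v‖) → False := by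
  sorry

/-- SUB-GOAL J (v15, lead c14): **the anchored synchronised floor** — one anchor coordinate `s_{k₀}` with `e^{s_{k₀}}` algebraic,
all other coordinates algebraic non-zero ⇒ no eventual type with `a < 1/n` at `(s, e^s)`. -/
theorem stub_anchoredSyncFloor : ∀ (n : ℕ) (s : Fin n → ℂ) (k₀ : Fin n) (a b C : ℝ),
    (∀ k, k ≠ k₀ → IsAlgebraic ℚ (s k)) → (∀ k, k ≠ k₀ → s k ≠ 0) →
    IsAlgebraic ℚ (Complex.exp (s k₀)) → a < 1 / (n : ℝ) → ¬ ApproxTypeEvAt n s a b C := by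
  sorry

/-- SUB-GOAL K (v15, lead c14): **the flagship floor** — at `(1, iπ)` no eventual approximation type has `a < 1/2`. -/
theorem stub_flagshipFloorHalf : ∀ (a b C : ℝ), a < 1 / 2 →
    ¬ ApproxTypeEvAt 2 ![(1 : ℂ), Complex.I * Real.pi] a b C := by
  sorry

/-- Leaf A's window AT THE FLAGSHIP POINT (sorry-free composition of sub-goal K): whatever exponent `stub_evNonLW_two` is proved
with, at `(1, iπ)` it is `≥ 1/2` (and `< 1` by the leaf's demand). -/
theorem evNonLWTwo_flagship_exponent_ge_half (a b C : ℝ) (h : ApproxTypeEvAt 2 ![(1 : ℂ), Complex.I * Real.pi] a b C) :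
    1 / 2 ≤ a := by
  by_contra hlt
  exact stub_flagshipFloorHalf a b C (not_le.mp hlt) h

/-- Leaf B's window, lower end, at every rank (sorry-free composition of sub-goal I): whatever exponent `stub_evLW_rankThreeUp`
is proved with at an LW point of rank `n ≥ 3`, it is `≥ 1/n`. -/
theorem evLW_exponent_ge_inv_rank {n : ℕ} (hn : 3 ≤ n) (s : Fin n → ℂ) (halg : ∀ i, IsAlgebraic ℚ (s i))
    (hli : LinearIndependent ℚ s) (a b C : ℝ) (h : ApproxTypeEvAt n s a b C) : 1 / (n : ℝ) ≤ a := by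
  by_contra hlt
  exact stub_lwSynchronisedFloor n s a b C (by omega) halg (fun i => hli.ne_zero i) (not_le.mp hlt) h

/-! ## Composition (sorry-free) -/

/-- v6's stub 7 is the conjunction of stubs B and C (`evRankThreeUp_of_layers`, p136816). -/
theorem evRankThreeUp_of_stubs : EvRankThreeUp :=
  evRankThreeUp_of_layers stub_evLW_rankThreeUp stub_evNonLW_rankThreeUp

/-- The three layers give the crux, pointwise form (kept from v6 for the anchored consumers). -/
theorem khovanskiiApproxTypeEv_of_layers (hLW : EvLWTwo) (hN : EvNonLWTwo) (hR : EvRankThreeUp) :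
    ∀ (n : ℕ) (s : Fin n → ℂ), 2 ≤ n → LinearIndependent ℚ s → IsFreeKhovanskii n s →
      ∃ a b C : ℝ, a < 1 / ((n : ℝ) - 1) ∧ ApproxTypeEvAt n s a b C := by
  intro n s hn hli hfree
  by_cases h3 : 3 ≤ n
  · exact hR n s h3 hli hfree
  obtain rfl : n = 2 := by omega
  have key : ∃ a b C : ℝ, a < 1 ∧ ApproxTypeEvAt 2 s a b C := by
    by_cases halg : ∀ i, IsAlgebraic ℚ (s i)
    · exact hLW s halg hli
    · push Not at halg
      exact hN s hli hfree halg
  obtain ⟨a, b, C, ha, hat⟩ := key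
  refine ⟨a, b, C, ?_, hat⟩
  have h1 : (1 : ℝ) / (((2 : ℕ) : ℝ) - 1) = 1 := by norm_num
  rw [h1]
  exact ha

/-- **The skeleton concludes the crux BY NAME.** `KhovanskiiApproxTypeEv` (route `DiophantineDichotomy`,
stmt-Schanuel-14972) from the three registered stubs = the three leaves of the typed split
(`khovanskiiApproxTypeEv_iff_threeLayers`, p136816; the landed rank-2 LW layer `stub_evLW_two` is inside it). -/
theorem KhovanskiiApproxTypeEv_of : KhovanskiiApproxTypeEv :=
  khovanskiiApproxTypeEv_iff_threeLayers.2
    ⟨stub_evNonLW_two, stub_evLW_rankThreeUp, stub_evNonLW_rankThreeUp⟩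

/-- The same conclusion through v6's route (`khovanskiiApproxTypeEv_iff` + the pointwise case split), as a
cross-check that the reshaped stub set still feeds the anchored consumers. -/
theorem KhovanskiiApproxTypeEv_of' : KhovanskiiApproxTypeEv :=
  khovanskiiApproxTypeEv_iff.2
    (khovanskiiApproxTypeEv_of_layers stub_evLW_two stub_evNonLW_two evRankThreeUp_of_stubs)

end Summit.Schanuel.Schanuel.Cruxes.KhovanskiiApproxTypeEv.AnchoredReduction

end
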